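import Summits.QuantumFields.QCD.Theorems.AnomalyRigidityUniformGapTreeDecayZeroFlavourGap
import Summits.QuantumFields.QCD.Theorems.UniformGapTreeDecay.Negative.UniformGapTreeDecayFalseOfGapped

/-!
# `AnomalyRigidity.UniformGapTreeDecay` (item stmt-QuantumFields-16260) is FALSE as typed

Route `AnomalyRigidity` (QCD sub-problem), support item ⟨stmt-QuantumFields-16260⟩
`UniformGapTreeDecay`.  REFUTED-MISSTATED: the item quantifies over ALL `N_f`, ALL regularisations
and ALL observables `V_μ, P` with weights, and concludes exponential TREE DECAY of the UNTRUNCATED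
three-point function; for the unit observables `V_μ = P = 1` (weights `1`) every hypothesis holds
while `⟨1·1·1⟩ = 1` cannot decay.  The tree's negative lemma
`UniformGapTreeDecay.Negative.uniformGapTreeDecay_false_of_gapped : GappedUnitRegularisation N_f →
¬ UniformGapTreeDecay` (refuter route review, 2026-08-16) is taken modulo a regularisation with a
uniform lattice gap on the mass window, bare masses on the physical branch and `⟨1⟩ = 1`; here that
hypothesis is CONSTRUCTED at `N_f = 0` (`gappedUnitRegularisation_zero`: `a_k = 1/(k+1)`,
`β_k ≡ 0`, `L_k = (k+1)²`, `m_crit ≡ 0`, `Z_m ≡ 1` — the product Haar measure, no quarks; files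
`AnomalyRigidityUniformGapTreeDecayEmptyFlavour.lean`, `…ZeroFlavourGap.lean`), and the
unconditional refutation `not_UniformGapTreeDecay` follows.

Witness: `N_f = 0`, `reg` as above, `V_μ = P = QCDLatticeObservable.one 0 1`, `u_V = u_P = 1`,
`ε = m₁ = 1`.  Minimal repaired statement `C′` (misses the witness): add the CENTRING hypotheses
`⟨V_μ(x)⟩ = ⟨P(x)⟩ = 0` on the mass window and restrict `N_f ∈ {2, 3}` — exactly the planner's
replacement crux `UniformGapFarMoments` (stmt-QuantumFields-17718), already filed; the witness
fails `C′` because `⟨1⟩ = 1 ≠ 0` (and `N_f = 0`).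

HONEST LABEL: ledger hygiene on a superseded, held support item; no crux, rung or summit is
touched; neither QCD nor the Yang–Mills mass gap is proved (or disproved) by this.  Seat
`ym-line-fcl-p3` g20 (free hands).
-/

noncomputable section

namespace Summit.QuantumFields.QCD.Theorems

open Filter Topology
open Literature.MathematicalPhysics.QuantumFieldTheory

/-- **`H` holds at `N_f = 0`**: the regularisation `a_k = 1/(k+1)`, `β_k ≡ 0`, `L_k = (k+1)²`,
`m_crit ≡ 0`, `Z_m ≡ 1` of flavourless lattice QCD (the product Haar measure) is a
`GappedUnitRegularisation 0`: uniform lattice gap `ε = 1` on the whole mass window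
(`EmptyFlavour.hasLatticeMassGap_zero_flavour_beta_zero`), the physical-branch clause is vacuous
(`Fin 0`), and `⟨1⟩ = 1` (`EmptyFlavour.qcdTorusExpect_one_zero_flavour`). -/
theorem gappedUnitRegularisation_zero : UniformGapTreeDecay.Negative.GappedUnitRegularisation 0 := by
  set z : SpeciesScheme Unit := SpeciesScheme.zero Unit with hz
  refine ⟨⟨z.a, z.a_pos, z.tendsto_a, fun _ => 0, z.L, z.tendsto_L, fun _ => 0, fun _ => 1,
    fun _ => one_pos⟩, 1, one_pos, fun m _ _ => ?_, fun _ _ _ fl => fl.elim0, fun m k S => ?_⟩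
  · exact UniformGapTreeDecay.EmptyFlavour.hasLatticeMassGap_zero_flavour_beta_zero _ (fun _ => rfl) 1
  · exact UniformGapTreeDecay.EmptyFlavour.qcdTorusExpect_one_zero_flavour _ _ _

/-- **Item stmt-QuantumFields-16260 `AnomalyRigidity.UniformGapTreeDecay` is false** (refuted,
class MISSTATED): the negative lemma `uniformGapTreeDecay_false_of_gapped` fed with the flavourless
product-Haar regularisation `gappedUnitRegularisation_zero`.  Repair `C′` = centred, `N_f ∈ {2,3}`
version = the route's `UniformGapFarMoments` (stmt-QuantumFields-17718). -/
theorem not_UniformGapTreeDecay : ¬ Summit.QuantumFields.QCD.Theses.AnomalyRigidity.UniformGapTreeDecay :=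
  UniformGapTreeDecay.Negative.uniformGapTreeDecay_false_of_gapped gappedUnitRegularisation_zero

end Summit.QuantumFields.QCD.Theorems

end
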